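import Summits.AtomisticToContinuum.Crystallization.Theses.ChessboardParticlePlanes

/-!
# Route ChessboardParticlePlanes — item 6712 `LayerConfinedCompetitors`: reductions

Item `stmt-AtomisticToContinuum-6712` (support of route `ChessboardParticlePlanes`) asks, for every
`ε > 0`, for a periodic configuration of `ℝ³` which is `2/3`-separated, confined to horizontal
planes whose occupied heights are pairwise `≥ 3/4` apart, and whose Lennard-Jones energy per
particle is `≤ ⨅_Q e(Q) + ε`.  As a standalone statement this says that the periodic Lennard-Jones
infimum is attained in the limit INSIDE the laminar class, which is a (weak, periodic) form of the
layering problem for Lennard-Jones ground states and is not provable from what the tree knows; in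
the route it is the OUTPUT of `LaminarPeriodisation` applied to the crux `LjLaminarWindows`, or of
`HcpPeriodicMinimiser` when the minimising relaxed hcp has layer spacing `h ≥ 3/4`.

This file records the sorry-free reductions that make those two closures one-liners:

* `layerConfinedCompetitors_iff_forall_le` — the `⨅` unfolded with the landed
  `CrysPeriodicBddBelow` (`bddBelow_energyPerParticle_lennardJones`): the item is equivalent to
  "for every `ε > 0` some configuration of the class is within `ε` of EVERY periodic configuration";
* `layerConfinedCompetitors_of_forall_le` — a minimiser inside the class settles the item;
* `hcp_two_thirds_le_dist`, `hcp_three_quarters_le_abs_sub` — relaxed hcp with `a ≥ 2/3`,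
  `h ≥ 3/4` lies in the class (uniform discreteness `min a h` of Barlow stackings and the layer
  planes `x₂ = k h`);
* `layerConfinedCompetitors_of_hcp_forall_le` / `…_of_isLeast_hcp` — hence any least relaxed hcp
  with `a ≥ 2/3`, `h ≥ 3/4` (in particular the conjectured minimiser `a ≈ 0.971`, `h ≈ 0.793`)
  settles the item.
-/

namespace Summit.AtomisticToContinuum.Crystallization.Theorems.LayerConfined

open Literature.MathematicalPhysics.StatisticalMechanics
open Summit.AtomisticToContinuum.Crystallization.Theses.ChessboardParticlePlanes

/-- **`⨅` unfolded.** `LayerConfinedCompetitors` is equivalent to: for every `ε > 0` there is a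
`2/3`-separated periodic configuration confined to horizontal planes with occupied heights pairwise
`≥ 3/4` apart whose Lennard-Jones energy per particle is within `ε` of that of EVERY periodic
configuration.  Uses only that the energies per particle are bounded below
(`ChargedEnergyGapNegative.bddBelow_energyPerParticle_lennardJones`, item 0714). [folklore] -/
theorem layerConfinedCompetitors_iff_forall_le :
    LayerConfinedCompetitors ↔
      ∀ ε : ℝ, 0 < ε → ∃ Q : PeriodicConfiguration 3,
        (∀ x ∈ Q.points, ∀ y ∈ Q.points, x ≠ y → (2 : ℝ) / 3 ≤ dist x y) ∧
        (∀ x ∈ Q.points, ∀ y ∈ Q.points, x 2 ≠ y 2 → (3 : ℝ) / 4 ≤ |x 2 - y 2|) ∧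
        ∀ Q' : PeriodicConfiguration 3,
          Q.energyPerParticle lennardJones ≤ Q'.energyPerParticle lennardJones + ε := by
  unfold LayerConfinedCompetitors
  constructor
  · intro h ε hε
    obtain ⟨Q, hsep, hlam, hle⟩ := h ε hε
    refine ⟨Q, hsep, hlam, fun Q' => hle.trans ?_⟩
    gcongr
    exact ciInf_le ChargedEnergyGapNegative.bddBelow_energyPerParticle_lennardJones Q'
  · intro h ε hε
    obtain ⟨Q, hsep, hlam, hle⟩ := h ε hε
    refine ⟨Q, hsep, hlam, ?_⟩
    have : Q.energyPerParticle lennardJones - ε ≤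
        ⨅ Q' : PeriodicConfiguration 3, Q'.energyPerParticle lennardJones :=
      le_ciInf fun Q' => by linarith [hle Q']
    linarith

/-- **A minimiser inside the class settles the item**: if some `2/3`-separated periodic
configuration confined to horizontal planes with heights pairwise `≥ 3/4` apart has Lennard-Jones
energy per particle `≤` that of every periodic configuration, then `LayerConfinedCompetitors`
holds (take it for every `ε`). [folklore] -/
theorem layerConfinedCompetitors_of_forall_le {Q : PeriodicConfiguration 3}
    (hsep : ∀ x ∈ Q.points, ∀ y ∈ Q.points, x ≠ y → (2 : ℝ) / 3 ≤ dist x y)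
    (hlam : ∀ x ∈ Q.points, ∀ y ∈ Q.points, x 2 ≠ y 2 → (3 : ℝ) / 4 ≤ |x 2 - y 2|)
    (hmin : ∀ Q' : PeriodicConfiguration 3,
      Q.energyPerParticle lennardJones ≤ Q'.energyPerParticle lennardJones) :
    LayerConfinedCompetitors :=
  layerConfinedCompetitors_iff_forall_le.2 fun _ε hε =>
    ⟨Q, hsep, hlam, fun Q' => (hmin Q').trans (le_add_of_nonneg_right hε.le)⟩

/-- **Relaxed hcp is `2/3`-separated** when `a ≥ 2/3` and `h ≥ 3/4`: distinct points of the Barlow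
stacking `hcpStacking a h` are at distance `≥ min a h ≥ 2/3`
(`le_dist_of_mem_barlowStacking`). [folklore] -/
theorem hcp_two_thirds_le_dist {a h : ℝ} (ha : (2 : ℝ) / 3 ≤ a) (hh : (3 : ℝ) / 4 ≤ h)
    (ha0 : a ≠ 0) (hh0 : h ≠ 0) :
    ∀ x ∈ (hcpPeriodicConfiguration ha0 hh0).points,
      ∀ y ∈ (hcpPeriodicConfiguration ha0 hh0).points, x ≠ y → (2 : ℝ) / 3 ≤ dist x y := by
  intro x hx y hy hxy
  rw [hcpPeriodicConfiguration_points] at hx hy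
  have hmin : (2 : ℝ) / 3 ≤ min a h := le_min ha (by linarith)
  have ha' : (0 : ℝ) ≤ a := by linarith
  have hh' : (0 : ℝ) ≤ h := by linarith
  exact hmin.trans (le_dist_of_mem_barlowStacking a h alternatingHagg ha' hh' hx hy hxy)

/-- **Relaxed hcp is laminar with heights `≥ 3/4` apart** when `h ≥ 3/4`: its points lie on the
planes `x₂ = k h`, `k ∈ ℤ` (`barlowPos_apply_two`), so two distinct occupied heights differ by a
non-zero integer multiple of `h`. [folklore] -/
theorem hcp_three_quarters_le_abs_sub {a h : ℝ} (hh : (3 : ℝ) / 4 ≤ h) (ha0 : a ≠ 0) (hh0 : h ≠ 0) :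
    ∀ x ∈ (hcpPeriodicConfiguration ha0 hh0).points,
      ∀ y ∈ (hcpPeriodicConfiguration ha0 hh0).points,
        x 2 ≠ y 2 → (3 : ℝ) / 4 ≤ |x 2 - y 2| := by
  intro x hx y hy hxy
  rw [hcpPeriodicConfiguration_points] at hx hy
  obtain ⟨k, i, j, rfl⟩ := hx
  obtain ⟨k', i', j', rfl⟩ := hy
  rw [barlowPos_apply_two, barlowPos_apply_two] at hxy ⊢
  have hk : k ≠ k' := by
    rintro rfl
    exact hxy rfl
  have h1 : (1 : ℝ) ≤ |(k : ℝ) - k'| := by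
    rw [← Int.cast_sub, ← Int.cast_abs]
    exact_mod_cast Int.one_le_abs (sub_ne_zero.2 hk)
  rw [← sub_mul, abs_mul, abs_of_nonneg (by linarith : (0 : ℝ) ≤ h)]
  nlinarith

/-- **A least relaxed hcp with `a ≥ 2/3`, `h ≥ 3/4` settles the item**: if
`e(hcp a h) ≤ e(Q')` for every periodic `Q'`, then `LayerConfinedCompetitors` (the hcp itself is
the competitor for every `ε`).  This is the closure of item 6712 through `HcpPeriodicMinimiser`
(stmt-3061) whenever the minimising box point has `h ≥ 3/4` — automatic for the conjectured
minimiser `h ≈ 0.793`, NOT for the whole box `h ≥ 39/50 · 47/50 = 0.7332` of 3061. [folklore] -/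
theorem layerConfinedCompetitors_of_hcp_forall_le {a h : ℝ} (ha : (2 : ℝ) / 3 ≤ a)
    (hh : (3 : ℝ) / 4 ≤ h) (ha0 : a ≠ 0) (hh0 : h ≠ 0)
    (hmin : ∀ Q' : PeriodicConfiguration 3,
      (hcpPeriodicConfiguration ha0 hh0).energyPerParticle lennardJones ≤
        Q'.energyPerParticle lennardJones) :
    LayerConfinedCompetitors :=
  layerConfinedCompetitors_of_forall_le (hcp_two_thirds_le_dist ha hh ha0 hh0)
    (hcp_three_quarters_le_abs_sub hh ha0 hh0) hmin

/-- **`IsLeast` form**: a relaxed hcp with `a ≥ 2/3`, `h ≥ 3/4` that is a least element of the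
Lennard-Jones energies per particle of periodic configurations settles `LayerConfinedCompetitors`.
[folklore] -/
theorem layerConfinedCompetitors_of_isLeast_hcp {a h : ℝ} (ha : (2 : ℝ) / 3 ≤ a)
    (hh : (3 : ℝ) / 4 ≤ h) (ha0 : a ≠ 0) (hh0 : h ≠ 0)
    (hleast : IsLeast (Set.range fun Q : PeriodicConfiguration 3 => Q.energyPerParticle lennardJones)
      ((hcpPeriodicConfiguration ha0 hh0).energyPerParticle lennardJones)) :
    LayerConfinedCompetitors :=
  layerConfinedCompetitors_of_hcp_forall_le ha hh ha0 hh0 fun Q' => hleast.2 ⟨Q', rfl⟩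

/-- **The route's own closure, recorded**: `LaminarPeriodisation` applied to `LjLaminarWindows`
gives `LayerConfinedCompetitors` (items 6713 and 6711; this is why the item is a redundant
hypothesis of the route's deciding theorem). [folklore] -/
theorem layerConfinedCompetitors_of_laminarPeriodisation (hper : LaminarPeriodisation)
    (hwin : LjLaminarWindows) : LayerConfinedCompetitors :=
  hper hwin

end Summit.AtomisticToContinuum.Crystallization.Theorems.LayerConfined
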